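import Summits.ValiantsHypothesis.ValiantsHypothesis.Theorems.KPlusLogSqLawTropicalBRegisterPair
import Summits.ValiantsHypothesis.ValiantsHypothesis.Theorems.KPlusLogSqLawTropicalBTranspose

/-!
# Route «KPlusLogSqLaw», crux `TropicalB` (stmt-ValiantsHypothesis-19771) — THE REGISTER-PAIR LAW, column side

HONEST FRAMING.  Helper toward the registered stubs `stub_tropThin` / `stub_tropFat` of `Cruxes/TropicalB/Lines/birth.lean` (crux
`Summit.ValiantsHypothesis.ValiantsHypothesis.Theses.KPlusLogSqLaw.TropicalB`, item stmt-ValiantsHypothesis-19771, route KPlusLogSqLaw;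
cell `pub-symmetroid`, seat val-sym-trop-p4 g11, 2026-08-27; `--supports … --as helper`).  The register-pair law
(`RegisterPair.registerPair_law`, …TropicalBRegisterPair) for two registers exposing COLUMN holes read by a gadget made of ROWS, obtained
from the row version through the tree's transposition transport (`isDominant_transpose_iff`, …TropicalBTranspose).  A STRUCTURE (no-go)
theorem about unique optima of an arbitrary design; nothing here bounds `TropicalB`, and nothing bears on `WeakLifting`, DoorA26 / DoorA34,
`MatrixDescartes` (stmt-ValiantsHypothesis-18050) or VP ≠ VNP.

THE LAW (`registerPair_law_cols`).  Fix a set `G` of ROWS (the gadget), a set `N` of columns and one class `l₀`; `cI`, `cJ` are the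
column holes of two registers (injective, disjoint images, off `N`).  There are no nine terms `u a b` (`a, b : Fin 3`), each the unique
optimum at an integer slope `θ a b` increasing in `a` and in `b`, such that the gadget rows are matched (with class `l₀`) exactly onto the
columns `N ∪ {cI a, cJ b}` and every other row's (column, class) depends on `a` alone or on `b` alone.  With the row version: two hole
registers on the SAME side of the matrix — rows or columns — never host a `3 × 3` product of dominant terms through one one-class gadget.
[folklore: valuated-matroid exchange (Murota 2003 §9) + hull convexity; transport by transposition; the packaging is the cell's]
-/

set_option linter.dupNamespace false
set_option autoImplicit false

namespace Summit.ValiantsHypothesis.ValiantsHypothesis.Theorems.KPlusLogSqLaw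

namespace RegisterPair

open Summit.ValiantsHypothesis.ValiantsHypothesis.Theorems.MatrixDescartes.Negative
open scoped BigOperators
open Finset

variable {m K : ℕ}

/-- the transposition transport `(σ, λ) ↦ (σ⁻¹, λ ∘ σ⁻¹)` is an involution. [folklore] -/
theorem transposeTerm_transposeTerm (q : Equiv.Perm (Fin m) × (Fin m → Fin K)) :
    (((q.1⁻¹, fun j => q.2 (q.1⁻¹ j)) : Equiv.Perm (Fin m) × (Fin m → Fin K)).1⁻¹,
      fun j => ((q.1⁻¹, fun j => q.2 (q.1⁻¹ j)) : Equiv.Perm (Fin m) × (Fin m → Fin K)).2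
        ((((q.1⁻¹, fun j => q.2 (q.1⁻¹ j)) : Equiv.Perm (Fin m) × (Fin m → Fin K)).1⁻¹) j)) = q := by
  refine Prod.ext (by simp) (funext fun j => ?_)
  simp

/-- **THE REGISTER-PAIR LAW, COLUMN SIDE** (no `3 × 3` product of dominant terms over two column-hole registers read by one gadget of
rows).  See the module docstring; `(u a b).1⁻¹ r` is the column matched to row `r`. [folklore; from `registerPair_law` by transposition] -/
theorem registerPair_law_cols (d : Fin K → ℕ) (v ε : Fin m → Fin m → Fin K → ℤ)
    (G N : Finset (Fin m)) (l₀ : Fin K) (cI cJ : Fin 3 → Fin m)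
    (u : Fin 3 → Fin 3 → Equiv.Perm (Fin m) × (Fin m → Fin K)) (θ : Fin 3 → Fin 3 → ℤ)
    (hdom : ∀ a b, IsDominant d v ε (θ a b) (u a b))
    (hθI : ∀ a a' b, a < a' → θ a b < θ a' b) (hθJ : ∀ a b b', b < b' → θ a b < θ a b')
    (hcls : ∀ a b, ∀ r ∈ G, (u a b).2 ((u a b).1⁻¹ r) = l₀)
    (himg : ∀ a b, G.image ⇑(u a b).1⁻¹ = insert (cI a) (insert (cJ b) N))
    (hIN : ∀ a, cI a ∉ N) (hJN : ∀ b, cJ b ∉ N) (hIJ : ∀ a b, cI a ≠ cJ b)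
    (hI : Function.Injective cI) (hJ : Function.Injective cJ)
    (hout : ∀ r, r ∉ G →
      (∀ a b b', ((u a b).1⁻¹ r, (u a b).2 ((u a b).1⁻¹ r)) = ((u a b').1⁻¹ r, (u a b').2 ((u a b').1⁻¹ r))) ∨
      (∀ a a' b, ((u a b).1⁻¹ r, (u a b).2 ((u a b).1⁻¹ r)) = ((u a' b).1⁻¹ r, (u a' b).2 ((u a' b).1⁻¹ r)))) :
    False := by
  -- the transposed family is dominant for the transposed design
  have hdom' : ∀ a b, IsDominant d (fun x y l => v y x l) (fun x y l => ε y x l) (θ a b)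
      (((u a b).1⁻¹ : Equiv.Perm (Fin m)), fun j => (u a b).2 ((u a b).1⁻¹ j)) := by
    intro a b
    rw [← isDominant_transpose_iff, transposeTerm_transposeTerm]
    exact hdom a b
  exact registerPair_law d (fun x y l => v y x l) (fun x y l => ε y x l) G N l₀ cI cJ
    (fun a b => (((u a b).1⁻¹ : Equiv.Perm (Fin m)), fun j => (u a b).2 ((u a b).1⁻¹ j))) θ hdom' hθI hθJ
    hcls himg hIN hJN hIJ hI hJ hout

end RegisterPair

end Summit.ValiantsHypothesis.ValiantsHypothesis.Theorems.KPlusLogSqLaw
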